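import Literature.NumberTheory.Transcendental.ZudilinPhiTable
import HarnessLib

/-!
# Growth of Zudilin's arithmetic factor: `Φₙ ≥ e^{176.6 n}` for all large `n`

Topic `Literature/NumberTheory/Transcendental`. The third analytic input of the proof of
[Zudilin2004, Theorem 3] (one of `ζ(5), ζ(7), ζ(9), ζ(11)` is irrational): the integer
`Φₙ = ∏_{√(91n+2) < p ≤ 33n} p^{ν_p}` ([Zudilin2004, (8.8)], `Zudilin2004.Phi`) satisfies

  `lim inf (log Φₙ)/n ≥ ∫₀¹ φ dψ − ∫₀^{1/33} φ dx/x² = 176.75055734…`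

([Zudilin2004, p. 270–271]: `ν_p ≥ φ(n/p)`, the `1`-periodic step function `φ`, and the prime
number theorem in the form `Σ_{p : {n/p} ∈ [u,v)} log p ∼ n (ψ(v) − ψ(u))`; this is the constant
`C₂ = 3·35 + 34 + 8·33 − 176.7505… = 226.2494…` of the proof of Theorem 3). We prove the
explicit consequence

* `Zudilin2004.Phi_growth` — **`e^{c₂ n} ≤ Φₙ` for all large `n`, with `c₂ = 883/5 = 176.6`**,

which is the hypothesis `hPhi` of the gluing theorem `Zudilin2004.zudilin_of_linearForms_of_lt`
(with `c₁ + c₂ > 403` it remains to have `|Sₙ| ≤ e^{−c₁ n}`, `c₁ > 226.4`; Zudilin's value is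
`C₀ = 227.58…`). Ingredients: `ν_{k,p} = φ₀(n/p, (k−1)/p)` and the certified table of
`φ = min_y φ₀` (`ZudilinPhi.lean`, `ZudilinPhiTable*.lean`), the decomposition of the primes by
`k = ⌊n/p⌋ ≤ 40` and the cell of `{n/p}`, `θ(n/(k+u)) − θ(n/(k+v)) ∼ n (1/(k+u) − 1/(k+v))`
(prime number theorem for `θ`, `Literature.NumberTheory.LFunctions.chebyshevTheta_isEquivalent`),
and the kernel-certified value of the truncated sum (`PhiCert.tableLB_gt`). Everything here is
PROVED (no named facts).

## References

* [Zudilin2004] W. Zudilin, *Arithmetic of linear forms involving odd zeta values*, J. Théor.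
  Nombres Bordeaux 16 (2004), 251–291, §8 (8.8)–(8.9), p. 270–271, Proposition 5, Theorem 3.
* [Hata1990] M. Hata, *Legendre type polynomials and irrationality measures*, J. reine angew.
  Math. 407 (1990), 99–125, Lemma 3.2 (the prime-number-theorem computation of such products).
-/

noncomputable section

open Finset Filter Topology Asymptotics

namespace Literature.NumberTheory.Transcendental

namespace Zudilin2004

namespace PhiCert

/-! ### Unpacking the certified table -/

/-- The left endpoint `u = a₀/b₀` of a cell. [cite: Zudilin2004, §8 p. 271] -/
def Cell.u (C : Cell) : ℝ := (C.a0 : ℝ) / C.b0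

/-- The right endpoint `v = a₁/b₁` of a cell. [cite: Zudilin2004, §8 p. 271] -/
def Cell.v (C : Cell) : ℝ := (C.a1 : ℝ) / C.b1

/-- What admissibility says. [folklore] -/
theorem Cell.adm_spec {C : Cell} (h : C.adm = true) :
    0 < C.b0 ∧ C.b0 ≤ 91 ∧ 0 < C.b1 ∧ 0 < C.a0 ∧ C.a0 * C.b1 < C.a1 * C.b0 ∧ C.a1 ≤ (C.b1 : ℤ)
      ∧ 0 ≤ C.c := by
  simpa [Cell.adm, Bool.and_eq_true, decide_eq_true_eq, and_assoc] using h

/-- Cells of the table are admissible. [cite: Zudilin2004, §8 p. 271] -/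
theorem adm_of_mem {C : Cell} (hC : C ∈ table) : C.adm = true :=
  List.all_eq_true.1 table_adm C hC

/-- `0 < b₀`. [folklore] -/
theorem b0_pos {C : Cell} (hC : C ∈ table) : 0 < C.b0 := (Cell.adm_spec (adm_of_mem hC)).1

/-- `0 < b₁`. [folklore] -/
theorem b1_pos {C : Cell} (hC : C ∈ table) : 0 < C.b1 := (Cell.adm_spec (adm_of_mem hC)).2.2.1

/-- `0 < u`. [cite: Zudilin2004, §8 p. 271] -/
theorem u_pos {C : Cell} (hC : C ∈ table) : 0 < C.u := by
  have h := Cell.adm_spec (adm_of_mem hC)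
  unfold Cell.u
  have : (0 : ℝ) < C.a0 := by exact_mod_cast h.2.2.2.1
  have : (0 : ℝ) < C.b0 := by exact_mod_cast h.1
  positivity

/-- `u < v`. [cite: Zudilin2004, §8 p. 271] -/
theorem u_lt_v {C : Cell} (hC : C ∈ table) : C.u < C.v := by
  have h := Cell.adm_spec (adm_of_mem hC)
  unfold Cell.u Cell.v
  have hb0 : (0 : ℝ) < C.b0 := by exact_mod_cast h.1
  have hb1 : (0 : ℝ) < C.b1 := by exact_mod_cast h.2.2.1
  rw [div_lt_div_iff₀ hb0 hb1]
  exact_mod_cast h.2.2.2.2.1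

/-- `v ≤ 1`. [cite: Zudilin2004, §8 p. 271] -/
theorem v_le_one {C : Cell} (hC : C ∈ table) : C.v ≤ 1 := by
  have h := Cell.adm_spec (adm_of_mem hC)
  unfold Cell.v
  have hb1 : (0 : ℝ) < C.b1 := by exact_mod_cast h.2.2.1
  rw [div_le_one hb1]
  exact_mod_cast h.2.2.2.2.2.1

/-- `0 ≤ c`. [cite: Zudilin2004, §8 p. 271] -/
theorem c_nonneg {C : Cell} (hC : C ∈ table) : 0 ≤ C.c := (Cell.adm_spec (adm_of_mem hC)).2.2.2.2.2.2

/-- `C.before C'` means `v ≤ u'`. [folklore] -/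
theorem before_iff {C C' : Cell} (hC : C ∈ table) (hC' : C' ∈ table) :
    C.before C' = true ↔ C.v ≤ C'.u := by
  unfold Cell.before Cell.u Cell.v
  have hb1 : (0 : ℝ) < C.b1 := by exact_mod_cast b1_pos hC
  have hb0 : (0 : ℝ) < C'.b0 := by exact_mod_cast b0_pos hC'
  rw [decide_eq_true_eq, div_le_div_iff₀ hb1 hb0]
  constructor
  · intro h; exact_mod_cast h
  · intro h; exact_mod_cast h

/-- A consecutive-pairs check gives all pairs, for a relation transitive through list members. [folklore] -/
theorem pairwise_of_chainB {α : Type*} {r : α → α → Bool} {P : α → Prop}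
    (ht : ∀ a b c, P b → r a b = true → r b c = true → r a c = true) :
    ∀ l : List α, (∀ a ∈ l, P a) → chainB r l = true → l.Pairwise (fun a b => r a b = true)
  | [], _, _ => List.Pairwise.nil
  | [a], _, _ => List.pairwise_singleton _ _
  | a :: b :: l, hP, h => by
    simp only [chainB, Bool.and_eq_true] at h
    have ih := pairwise_of_chainB ht (b :: l) (fun x hx => hP x (List.mem_cons_of_mem _ hx)) h.2
    refine List.Pairwise.cons ?_ ih
    intro x hx
    rcases List.mem_cons.1 hx with rfl | hx
    · exact h.1
    · exact ht _ _ _ (hP b (by simp)) h.1 (List.rel_of_pairwise_cons ih hx)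

/-- The cells are pairwise sorted. [cite: Zudilin2004, §8 p. 271] -/
theorem table_pairwise : table.Pairwise (fun C C' => C.before C' = true) := by
  refine pairwise_of_chainB (P := fun C => C ∈ table) ?_ table (fun _ h => h) table_chain
  intro a b c hb hab hbc
  -- through the reals would need `a, c ∈ table`; argue with integers instead
  unfold Cell.before at *
  rw [decide_eq_true_eq] at *
  have h := Cell.adm_spec (adm_of_mem hb)
  have hb0 : (0 : ℤ) < b.b0 := by exact_mod_cast h.1
  have hb1 : (0 : ℤ) < b.b1 := by exact_mod_cast h.2.2.1
  have huv : b.a0 * b.b1 < b.a1 * b.b0 := h.2.2.2.2.1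
  -- `a.a1 * b.b0 ≤ b.a0 * a.b1`, `b.a1 * c.b0 ≤ c.a0 * b.b1` ⟹ `a.a1 * c.b0 ≤ c.a0 * a.b1`
  by_contra hlt
  push Not at hlt
  rcases le_or_gt a.b1 0 with ha | ha
  · -- then `a.a1 * b.b0 ≤ b.a0 * a.b1 ≤ ...`: with `a.b1 ≤ 0` (as ℕ, `a.b1 = 0`)
    have ha0 : (a.b1 : ℤ) = 0 := by omega
    rw [ha0, mul_zero] at hab hlt
    rcases le_or_gt c.b0 0 with hc | hc
    · have : (c.b0 : ℤ) = 0 := by omega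
      rw [this] at hlt; simp at hlt
    · have h1 : a.a1 ≤ 0 := by nlinarith
      nlinarith
  · rcases le_or_gt c.b0 0 with hc | hc
    · have hc0 : (c.b0 : ℤ) = 0 := by omega
      rw [hc0] at hbc hlt
      simp only [mul_zero] at hbc hlt
      nlinarith
    · -- all denominators positive: divide
      have e1 : (a.a1 : ℚ) / a.b1 ≤ (b.a0 : ℚ) / b.b0 := by
        rw [div_le_div_iff₀ (by exact_mod_cast ha) (by exact_mod_cast hb0)]; exact_mod_cast hab
      have e2 : (b.a0 : ℚ) / b.b0 < (b.a1 : ℚ) / b.b1 := by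
        rw [div_lt_div_iff₀ (by exact_mod_cast hb0) (by exact_mod_cast hb1)]; exact_mod_cast huv
      have e3 : (b.a1 : ℚ) / b.b1 ≤ (c.a0 : ℚ) / c.b0 := by
        rw [div_le_div_iff₀ (by exact_mod_cast hb1) (by exact_mod_cast hc)]; exact_mod_cast hbc
      have e4 : (c.a0 : ℚ) / c.b0 < (a.a1 : ℚ) / a.b1 := by
        rw [div_lt_div_iff₀ (by exact_mod_cast hc) (by exact_mod_cast ha)]; exact_mod_cast hlt
      linarith

/-- The table has no duplicate cells. [folklore] -/
theorem table_nodup : table.Nodup := by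
  refine List.Pairwise.imp_of_mem ?_ table_pairwise
  intro C C' hC _ h hCC'
  subst hCC'
  rw [before_iff hC hC] at h
  exact absurd h (not_le.2 (u_lt_v hC))

/-- **Uniqueness of the cell**: a point lies in at most one cell of the table. [cite: Zudilin2004, §8 p. 271] -/
theorem eq_of_mem_cell {C C' : Cell} (hC : C ∈ table) (hC' : C' ∈ table) {t : ℝ}
    (h1 : C.u ≤ t) (h2 : t < C.v) (h1' : C'.u ≤ t) (h2' : t < C'.v) : C = C' := by
  by_contra hne
  let Rs : Cell → Cell → Prop := fun a b => a.before b = true ∨ b.before a = true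
  haveI : Std.Symm Rs := ⟨fun a b h => h.symm⟩
  have hp : table.Pairwise Rs := table_pairwise.imp fun h => Or.inl h
  rcases hp.forall hC hC' hne with h | h
  · rw [before_iff hC hC'] at h; linarith
  · rw [before_iff hC' hC] at h; linarith

/-! ### `ν_p ≥ c` on a cell -/

/-- **`ν_p ≥ φ(n/p)`**: if `{n/p}` lies in a cell of the table with bound `c`, then `ν_p ≥ c`
(`ν_{k,p} = φ₀(n/p, (k-1)/p) ≥ min_y φ₀({n/p}, y) ≥ c`). [cite: Zudilin2004, §8 p. 270] -/
theorem le_nuMin {C : Cell} (hC : C ∈ table) {n p : ℕ}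
    (h0 : (C.a0 : ℚ) / C.b0 < Int.fract ((n : ℚ) / p))
    (h1 : Int.fract ((n : ℚ) / p) < (C.a1 : ℚ) / C.b1) : C.c ≤ nuMin n p := by
  unfold nuMin
  refine (Finset.le_inf'_iff _ _).2 fun k _ => ?_
  rw [nu_eq_phi0, ← Int.fract_add_floor ((n : ℚ) / p), phi0_add_int]
  exact C.check_sound' (table_check C hC) h0 h1 _

/-! ### The prime ranges -/

/-- `X = n/(k+u)`: primes `p ≤ X` have `n/p ≥ k + u`. [cite: Zudilin2004, §8 p. 271] -/
def Cell.X (C : Cell) (k n : ℕ) : ℝ := n / (k + C.u)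

/-- `Y = n/(k+v)`: primes `p > Y` have `n/p < k + v`. [cite: Zudilin2004, §8 p. 271] -/
def Cell.Y (C : Cell) (k n : ℕ) : ℝ := n / (k + C.v)

/-- The primes `p` with `k + u ≤ n/p < k + v`, i.e. `Y < p ≤ X`. [cite: Zudilin2004, §8 p. 271] -/
def Cell.P (C : Cell) (k n : ℕ) : Finset ℕ := (Ioc ⌊C.Y k n⌋₊ ⌊C.X k n⌋₊).filter Nat.Prime

/-- `θ(X) − θ(Y) = Σ_{Y < p ≤ X} log p`. [folklore] -/
theorem theta_sub_theta {Y X : ℝ} (hYX : Y ≤ X) :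
    Chebyshev.theta X - Chebyshev.theta Y = ∑ p ∈ (Ioc ⌊Y⌋₊ ⌊X⌋₊).filter Nat.Prime, Real.log p := by
  unfold Chebyshev.theta
  have h : ⌊Y⌋₊ ≤ ⌊X⌋₊ := Nat.floor_le_floor hYX
  rw [← Finset.Ioc_union_Ioc_eq_Ioc (Nat.zero_le _) h, Finset.filter_union, Finset.sum_union]
  · ring
  · refine Finset.disjoint_filter_filter ?_
    rw [Finset.disjoint_left]
    intro a ha hb
    rw [Finset.mem_Ioc] at ha hb
    omega

variable {C : Cell} {k n p : ℕ}

/-- `0 ≤ X`. [folklore] -/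
theorem X_nonneg (hC : C ∈ table) : 0 ≤ C.X k n := by
  unfold Cell.X; have := u_pos hC; positivity

/-- `0 ≤ Y`. [folklore] -/
theorem Y_nonneg (hC : C ∈ table) : 0 ≤ C.Y k n := by
  unfold Cell.Y; have := (u_pos hC).trans (u_lt_v hC); positivity

/-- `Y ≤ X`. [folklore] -/
theorem Y_le_X (hC : C ∈ table) : C.Y k n ≤ C.X k n := by
  unfold Cell.X Cell.Y
  have hu := u_pos hC; have huv := u_lt_v hC
  exact div_le_div_of_nonneg_left (Nat.cast_nonneg n) (by positivity) (by linarith)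

/-- Membership in `P`: `p` prime with `k + u ≤ n/p < k + v`. [cite: Zudilin2004, §8 p. 271] -/
theorem mem_P (hC : C ∈ table) (hp : p ∈ C.P k n) :
    p.Prime ∧ 0 < p ∧ (k : ℝ) + C.u ≤ (n : ℝ) / p ∧ (n : ℝ) / p < k + C.v := by
  unfold Cell.P at hp
  rw [Finset.mem_filter, Finset.mem_Ioc] at hp
  obtain ⟨⟨hY, hX⟩, hprime⟩ := hp
  have hu := u_pos hC; have huv := u_lt_v hC
  have hv : 0 < C.v := hu.trans huv
  have hp0 : 0 < p := hprime.pos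
  have hp0' : (0 : ℝ) < p := by exact_mod_cast hp0
  rw [Nat.floor_lt (Y_nonneg hC)] at hY
  rw [Nat.le_floor_iff (X_nonneg hC)] at hX
  unfold Cell.Y at hY; unfold Cell.X at hX
  refine ⟨hprime, hp0, ?_, ?_⟩
  · rw [le_div_iff₀ hp0']
    rw [le_div_iff₀ (by positivity)] at hX
    linarith
  · rw [div_lt_iff₀ hp0']
    rw [div_lt_iff₀ (by positivity)] at hY
    linarith

/-- `Σ_{p ∈ P} log p = θ(X) − θ(Y)`. [folklore] -/
theorem sum_P_log (hC : C ∈ table) :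
    ∑ p ∈ C.P k n, Real.log p = Chebyshev.theta (C.X k n) - Chebyshev.theta (C.Y k n) := by
  rw [theta_sub_theta (Y_le_X hC)]; rfl

/-- The threshold beyond which all the ranges with `k ≤ K` consist of primes `p` with
`p² > 91n + 2`. [folklore] -/
def N₀ : ℕ := 92 * (K + 1) ^ 2

/-- The primes of `Φₙ`. [cite: Zudilin2004, §8 (8.8)] -/
def PhiPrimes (n : ℕ) : Finset ℕ :=
  (range (33 * n + 1)).filter (fun p => p.Prime ∧ 91 * n + 2 < p ^ 2)

/-- `Φₙ` as a product over `PhiPrimes n`. [cite: Zudilin2004, §8 (8.8)] -/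
theorem Phi_eq (n : ℕ) : Phi n = ∏ p ∈ PhiPrimes n, p ^ (nuMin n p).toNat := rfl

/-- `0 < K`. [folklore] -/
theorem K_pos : 0 < K := by decide

/-- For `n ≥ N₀`, `k ≤ K` and a contributing pair, every `p ∈ P` is a prime of `Φₙ`, and `{n/p}`
lies in the open cell. [cite: Zudilin2004, §8 p. 271] -/
theorem mem_P_props (hC : C ∈ table) (hk : k ≤ K) (hgood : C.good k = true) (hn : N₀ ≤ n)
    (hp : p ∈ C.P k n) :
    p ∈ PhiPrimes n ∧ (C.a0 : ℚ) / C.b0 < Int.fract ((n : ℚ) / p)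
      ∧ Int.fract ((n : ℚ) / p) < (C.a1 : ℚ) / C.b1 := by
  obtain ⟨hprime, hp0, hlo, hhi⟩ := mem_P hC hp
  have hadm := Cell.adm_spec (adm_of_mem hC)
  have hu := u_pos hC
  have huv := u_lt_v hC
  have hv1 := v_le_one hC
  have hp0' : (0 : ℝ) < p := by exact_mod_cast hp0
  have hK : (k : ℝ) ≤ K := by exact_mod_cast hk
  have hn' : (92 : ℝ) * ((K : ℝ) + 1) ^ 2 ≤ n := by
    have : ((92 * (K + 1) ^ 2 : ℕ) : ℝ) ≤ n := by exact_mod_cast hn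
    push_cast at this
    exact this
  have hK1 : (1 : ℝ) ≤ (K : ℝ) + 1 := by linarith [(Nat.cast_nonneg K : (0 : ℝ) ≤ K)]
  -- `p > n/(K+1) ≥ 92 (K+1)`
  have hpl : (n : ℝ) < p * ((K : ℝ) + 1) := by
    have h1 : (n : ℝ) / p < (K : ℝ) + 1 := by linarith
    rw [div_lt_iff₀ hp0'] at h1
    linarith
  have hp92 : (92 : ℝ) * ((K : ℝ) + 1) < p := by
    by_contra hle
    push Not at hle
    have : (p : ℝ) * ((K : ℝ) + 1) ≤ 92 * ((K : ℝ) + 1) ^ 2 := by nlinarith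
    linarith
  have hp91 : (91 : ℝ) < p := by nlinarith
  -- `p ≤ 33 n`
  have hp33 : (p : ℝ) ≤ 33 * n := by
    have hku : (1 : ℝ) / 33 ≤ (k : ℝ) + C.u := by
      simp only [Cell.good, Bool.or_eq_true, decide_eq_true_eq] at hgood
      rcases hgood with hk1 | hb
      · have : (1 : ℝ) ≤ k := by exact_mod_cast hk1
        linarith
      · have hb0 : (0 : ℝ) < C.b0 := by exact_mod_cast hadm.1
        have hb' : ((C.b0 : ℤ) : ℝ) ≤ 33 * (C.a0 : ℝ) := by exact_mod_cast hb
        push_cast at hb'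
        have : (1 : ℝ) / 33 ≤ C.u := by
          unfold Cell.u
          rw [div_le_div_iff₀ (by norm_num) hb0]
          linarith
        linarith [(Nat.cast_nonneg k : (0 : ℝ) ≤ k)]
    have h1 : (1 : ℝ) / 33 ≤ (n : ℝ) / p := hku.trans hlo
    rw [le_div_iff₀ hp0'] at h1
    linarith
  -- `p² > 91 n + 2`
  have hsq : (91 : ℝ) * n + 2 < (p : ℝ) ^ 2 := by
    have h2 : (n : ℝ) ^ 2 < (p : ℝ) ^ 2 * ((K : ℝ) + 1) ^ 2 := by
      have := hpl
      nlinarith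
    have h3 : (92 : ℝ) * ((K : ℝ) + 1) ^ 2 * n ≤ (n : ℝ) ^ 2 := by nlinarith
    have h4 : (92 : ℝ) * n < (p : ℝ) ^ 2 := by
      have hKp : (0 : ℝ) < ((K : ℝ) + 1) ^ 2 := by positivity
      nlinarith
    have h92 : (92 : ℝ) * ((K : ℝ) + 1) ^ 2 ≥ 92 := by nlinarith
    nlinarith
  refine ⟨?_, ?_⟩
  · unfold PhiPrimes
    rw [Finset.mem_filter, Finset.mem_range]
    refine ⟨?_, hprime, ?_⟩
    · have : (p : ℝ) < 33 * n + 1 := by linarith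
      exact_mod_cast this
    · exact_mod_cast hsq
  -- the fractional part
  have hloQ : (k : ℚ) + (C.a0 : ℚ) / C.b0 ≤ (n : ℚ) / p := by
    have : ((k : ℚ) + (C.a0 : ℚ) / C.b0 : ℚ) ≤ (((n : ℚ) / p : ℚ) : ℝ) := by
      push_cast; exact hlo
    exact_mod_cast this
  have hhiQ : (n : ℚ) / p < (k : ℚ) + (C.a1 : ℚ) / C.b1 := by
    have : ((((n : ℚ) / p : ℚ)) : ℝ) < ((k : ℚ) + (C.a1 : ℚ) / C.b1 : ℚ) := by
      push_cast; exact hhi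
    exact_mod_cast this
  have ha0 : (0 : ℚ) < (C.a0 : ℚ) / C.b0 := by
    have h1 : (0 : ℚ) < C.a0 := by exact_mod_cast hadm.2.2.2.1
    have h2 : (0 : ℚ) < C.b0 := by exact_mod_cast hadm.1
    positivity
  have ha1 : (C.a1 : ℚ) / C.b1 ≤ 1 := by
    have h2 : (0 : ℚ) < C.b1 := by exact_mod_cast hadm.2.2.1
    rw [div_le_one h2]; exact_mod_cast hadm.2.2.2.2.2.1
  have hfloor : ⌊(n : ℚ) / p⌋ = k := by
    rw [Int.floor_eq_iff]
    push_cast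
    constructor <;> linarith
  have hfract : Int.fract ((n : ℚ) / p) = (n : ℚ) / p - k := by
    rw [Int.fract, hfloor]; push_cast; ring
  rw [hfract]
  refine ⟨?_, by linarith⟩
  -- strictness at the left endpoint: `n/p = k + a₀/b₀` would force `p ∣ n`
  rcases (show (k : ℚ) + (C.a0 : ℚ) / C.b0 ≤ (n : ℚ) / p from hloQ).lt_or_eq with hlt | heq
  · linarith
  · exfalso
    have hb0 : (0 : ℚ) < C.b0 := by exact_mod_cast hadm.1
    have hpq : (p : ℚ) ≠ 0 := by exact_mod_cast hp0.ne'
    -- `n b₀ = p (k b₀ + a₀)` in `ℤ`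
    have hZ : ((n * C.b0 : ℕ) : ℤ) = (p : ℤ) * ((k : ℤ) * C.b0 + C.a0) := by
      have hQ : ((n : ℚ) * C.b0) = (p : ℚ) * ((k : ℚ) * C.b0 + C.a0) := by
        field_simp at heq
        linarith
      have : (((n * C.b0 : ℕ) : ℤ) : ℚ) = (((p : ℤ) * ((k : ℤ) * C.b0 + C.a0) : ℤ) : ℚ) := by
        push_cast; linarith
      exact_mod_cast this
    have hdvd : (p : ℤ) ∣ ((n * C.b0 : ℕ) : ℤ) := ⟨_, hZ⟩
    have hdvd' : p ∣ n * C.b0 := by exact_mod_cast hdvd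
    rcases (Nat.Prime.dvd_mul hprime).1 hdvd' with hpn | hpb
    · -- then `n/p` is an integer and its fractional part vanishes
      obtain ⟨m, hm⟩ := hpn
      have : (n : ℚ) / p = m := by
        rw [hm]; push_cast; field_simp
      have hfr : Int.fract ((n : ℚ) / p) = 0 := by rw [this]; exact Int.fract_natCast m
      rw [hfract] at hfr
      linarith
    · have hle : p ≤ C.b0 := Nat.le_of_dvd hadm.1 hpb
      have : (p : ℝ) ≤ 91 := by
        have : (p : ℝ) ≤ C.b0 := by exact_mod_cast hle
        have hb91 : (C.b0 : ℝ) ≤ 91 := by exact_mod_cast hadm.2.1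
        linarith
      linarith

/-! ### The contributing pairs `(k, cell)` and the lower bound for `log Φₙ` -/

/-- The pairs `(k, C)`, `k ≤ K`, `C` a cell. [cite: Zudilin2004, §8 p. 271] -/
def pairs : Finset (ℕ × Cell) := (range (K + 1)) ×ˢ table.toFinset

/-- `k ≤ K` and `C ∈ table` from membership in the pairs. [folklore] -/
theorem mem_pairs {g : ℕ × Cell} (hg : g ∈ pairs) : g.1 ≤ K ∧ g.2 ∈ table := by
  unfold pairs at hg
  rw [Finset.mem_product, Finset.mem_range, List.mem_toFinset] at hg
  exact ⟨Nat.lt_succ_iff.1 hg.1, hg.2⟩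

/-- A prime determines its pair `(⌊n/p⌋, cell of {n/p})`. [cite: Zudilin2004, §8 p. 271] -/
theorem pair_unique {g g' : ℕ × Cell} (hg : g ∈ pairs) (hg' : g' ∈ pairs) (hp : p ∈ g.2.P g.1 n)
    (hp' : p ∈ g'.2.P g'.1 n) : g = g' := by
  obtain ⟨-, hC⟩ := mem_pairs hg
  obtain ⟨-, hC'⟩ := mem_pairs hg'
  obtain ⟨-, -, h1, h2⟩ := mem_P hC hp
  obtain ⟨-, -, h1', h2'⟩ := mem_P hC' hp'
  have hu := u_pos hC; have hv := v_le_one hC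
  have hu' := u_pos hC'; have hv' := v_le_one hC'
  have hk : g.1 = g'.1 := by
    have a1 : (g.1 : ℝ) < (g'.1 : ℝ) + 1 := by linarith
    have a2 : (g'.1 : ℝ) < (g.1 : ℝ) + 1 := by linarith
    have b1 : g.1 < g'.1 + 1 := by exact_mod_cast a1
    have b2 : g'.1 < g.1 + 1 := by exact_mod_cast a2
    omega
  have hC_eq : g.2 = g'.2 := by
    rw [hk] at h1 h2
    exact eq_of_mem_cell hC hC' (t := (n : ℝ) / p - g'.1) (by linarith) (by linarith) (by linarith)
      (by linarith)
  exact Prod.ext hk hC_eq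

/-- The contribution `c · (θ(n/(k+u)) − θ(n/(k+v)))` of a pair. [cite: Zudilin2004, §8 p. 271] -/
def contrib (g : ℕ × Cell) (n : ℕ) : ℝ :=
  if g.2.good g.1 = true then (g.2.c : ℝ) * (Chebyshev.theta (g.2.X g.1 n) - Chebyshev.theta (g.2.Y g.1 n))
  else 0

/-- The lower bound `L(n) = Σ_{(k,C)} c · (θ(n/(k+u)) − θ(n/(k+v)))`. [cite: Zudilin2004, §8 p. 271] -/
def Lfun (n : ℕ) : ℝ := ∑ g ∈ pairs, contrib g n

/-- The step function `Σ c · 1[p ∈ P(k,C)]` below `ν_p`. [cite: Zudilin2004, §8 p. 270] -/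
def sfun (n p : ℕ) : ℝ := ∑ g ∈ pairs, if g.2.good g.1 = true ∧ p ∈ g.2.P g.1 n then (g.2.c : ℝ) else 0

/-- `Σ c 1[p ∈ P] ≤ ν_p`. [cite: Zudilin2004, §8 p. 270] -/
theorem sfun_le (hn : N₀ ≤ n) (p : ℕ) : sfun n p ≤ ((nuMin n p).toNat : ℝ) := by
  by_cases h : ∃ g ∈ pairs, g.2.good g.1 = true ∧ p ∈ g.2.P g.1 n
  · obtain ⟨g, hg, hgood, hpg⟩ := h
    rw [sfun, Finset.sum_eq_single_of_mem g hg fun g' hg' hne =>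
      if_neg fun hh => hne (pair_unique hg' hg hh.2 hpg)]
    rw [if_pos ⟨hgood, hpg⟩]
    obtain ⟨hk, hC⟩ := mem_pairs hg
    obtain ⟨-, h0, h1⟩ := mem_P_props hC hk hgood hn hpg
    have h2 : g.2.c ≤ (nuMin n p).toNat := (le_nuMin hC h0 h1).trans (Int.self_le_toNat _)
    exact_mod_cast h2
  · push Not at h
    rw [sfun, Finset.sum_eq_zero fun g hg => if_neg fun hh => h g hg hh.1 hh.2]
    positivity

/-- `P(k, C) ⊆ primes of Φₙ` for contributing pairs and `n ≥ N₀`. [cite: Zudilin2004, §8 p. 271] -/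
theorem P_subset {g : ℕ × Cell} (hg : g ∈ pairs) (hgood : g.2.good g.1 = true) (hn : N₀ ≤ n) :
    g.2.P g.1 n ⊆ PhiPrimes n := fun _ hp =>
  (mem_P_props (mem_pairs hg).2 (mem_pairs hg).1 hgood hn hp).1

/-- `L(n) = Σ_{p ∣ Φₙ} (Σ c 1[p ∈ P]) log p`. [cite: Zudilin2004, §8 p. 271] -/
theorem Lfun_eq (hn : N₀ ≤ n) : Lfun n = ∑ p ∈ PhiPrimes n, sfun n p * Real.log p := by
  unfold Lfun sfun
  simp_rw [Finset.sum_mul, ite_mul, zero_mul]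
  rw [Finset.sum_comm]
  refine Finset.sum_congr rfl fun g hg => ?_
  unfold contrib
  by_cases hgood : g.2.good g.1 = true
  · simp only [hgood, true_and, if_true]
    rw [← Finset.sum_filter, Finset.filter_mem_eq_inter,
      Finset.inter_eq_right.2 (P_subset hg hgood hn), ← sum_P_log (mem_pairs hg).2, Finset.mul_sum]
  · simp [hgood]

/-- `log Φₙ = Σ ν_p log p`. [cite: Zudilin2004, §8 (8.8)] -/
theorem log_Phi (n : ℕ) :
    Real.log (Phi n) = ∑ p ∈ PhiPrimes n, ((nuMin n p).toNat : ℝ) * Real.log p := by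
  rw [Phi_eq]
  push_cast
  rw [Real.log_prod]
  · exact Finset.sum_congr rfl fun p _ => Real.log_pow _ _
  · intro p hp
    have : p.Prime := (Finset.mem_filter.1 hp).2.1
    exact pow_ne_zero _ (by exact_mod_cast this.ne_zero)

/-- **`L(n) ≤ log Φₙ`** for `n ≥ N₀`. [cite: Zudilin2004, §8 p. 270–271] -/
theorem Lfun_le_log_Phi (hn : N₀ ≤ n) : Lfun n ≤ Real.log (Phi n) := by
  rw [Lfun_eq hn, log_Phi]
  refine Finset.sum_le_sum fun p hp => ?_
  have hprime : p.Prime := (Finset.mem_filter.1 hp).2.1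
  have hlog : 0 ≤ Real.log p := Real.log_nonneg (by exact_mod_cast hprime.one_lt.le)
  exact mul_le_mul_of_nonneg_right (sfun_le hn p) hlog

/-! ### The limit `L(n)/n → C⋆` (prime number theorem) -/

/-- `θ(n/a)/n → 1/a`. [folklore] -/
theorem tendsto_theta_div {a : ℝ} (ha : 0 < a) :
    Tendsto (fun n : ℕ => Chebyshev.theta (n / a) / n) atTop (𝓝 (1 / a)) := by
  have hθ : Tendsto (fun x : ℝ => Chebyshev.theta x / x) atTop (𝓝 1) := by
    have h := Literature.NumberTheory.LFunctions.chebyshevTheta_isEquivalent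
    have hz : ∀ᶠ x : ℝ in atTop, (fun x : ℝ => x) x ≠ 0 := by
      filter_upwards [eventually_gt_atTop 0] with x hx using hx.ne'
    exact (isEquivalent_iff_tendsto_one hz).1 h
  have hx : Tendsto (fun n : ℕ => (n : ℝ) / a) atTop atTop :=
    tendsto_natCast_atTop_atTop.atTop_div_const ha
  have h1 := (hθ.comp hx).mul_const (1 / a)
  rw [one_mul] at h1
  refine h1.congr' ?_
  filter_upwards [eventually_gt_atTop 0] with n hn
  have hn' : (n : ℝ) ≠ 0 := by exact_mod_cast hn.ne'
  simp only [Function.comp_apply]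
  field_simp

/-- The limit of a pair's contribution. [cite: Zudilin2004, §8 p. 271] -/
def climit (g : ℕ × Cell) : ℝ :=
  if g.2.good g.1 = true then (g.2.c : ℝ) * (1 / (g.1 + g.2.u) - 1 / (g.1 + g.2.v)) else 0

/-- `contrib/n → climit`. [cite: Zudilin2004, §8 p. 271] -/
theorem tendsto_contrib_div {g : ℕ × Cell} (hg : g ∈ pairs) :
    Tendsto (fun n : ℕ => contrib g n / n) atTop (𝓝 (climit g)) := by
  obtain ⟨-, hC⟩ := mem_pairs hg
  have hu := u_pos hC; have huv := u_lt_v hC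
  have hv : 0 < g.2.v := hu.trans huv
  unfold contrib climit
  by_cases hgood : g.2.good g.1 = true
  · simp only [hgood, if_true]
    have hX := tendsto_theta_div (a := (g.1 : ℝ) + g.2.u) (by positivity)
    have hY := tendsto_theta_div (a := (g.1 : ℝ) + g.2.v) (by positivity)
    refine ((hX.sub hY).const_mul (g.2.c : ℝ)).congr' (Eventually.of_forall fun n => ?_)
    simp only [Cell.X, Cell.Y]
    ring
  · simp only [hgood]
    simp

/-- The limiting constant `C⋆ = Σ_{(k,C)} c (1/(k+u) − 1/(k+v))`. [cite: Zudilin2004, §8 p. 271] -/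
def Cstar : ℝ := ∑ g ∈ pairs, climit g

/-- **`L(n)/n → C⋆`**. [cite: Zudilin2004, §8 p. 271] -/
theorem tendsto_Lfun_div : Tendsto (fun n : ℕ => Lfun n / n) atTop (𝓝 Cstar) := by
  have : (fun n : ℕ => Lfun n / n) = fun n : ℕ => ∑ g ∈ pairs, contrib g n / n := by
    funext n; rw [Lfun, Finset.sum_div]
  rw [this]
  exact tendsto_finsetSum _ fun g hg => tendsto_contrib_div hg

/-! ### The certified value of `C⋆` -/

/-- `range`-sums as list sums. [folklore] -/
theorem sum_range_eq_list_sum {β : Type*} [AddCommMonoid β] (f : ℕ → β) (m : ℕ) :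
    ∑ k ∈ range m, f k = ((List.range m).map f).sum := by
  induction m with
  | zero => simp
  | succ m ih => rw [Finset.sum_range_succ, List.range_succ, List.map_append, List.sum_append, ih]; simp

/-- The integer bound of one term is below the real term. [folklore] -/
theorem lbTerm_le (hC : C ∈ table) (k : ℕ) :
    (C.lbTerm k : ℝ) ≤ M * ((C.c : ℝ) * (1 / (k + C.u) - 1 / (k + C.v))) := by
  have hadm := Cell.adm_spec (adm_of_mem hC)
  have hb0 : (0 : ℤ) < C.b0 := by exact_mod_cast hadm.1
  have hb1 : (0 : ℤ) < C.b1 := by exact_mod_cast hadm.2.2.1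
  have ha0 : (0 : ℤ) < C.a0 := hadm.2.2.2.1
  have ha1 : (0 : ℤ) < C.a1 := by nlinarith [hadm.2.2.2.2.1]
  have hc : (0 : ℝ) ≤ C.c := by exact_mod_cast hadm.2.2.2.2.2.2
  set D0 : ℤ := (k : ℤ) * C.b0 + C.a0 with hD0
  set D1 : ℤ := (k : ℤ) * C.b1 + C.a1 with hD1
  have hD0p : 0 < D0 := by rw [hD0]; positivity
  have hD1p : 0 < D1 := by rw [hD1]; positivity
  -- floor part
  have h1 : (((M : ℤ) * C.b0 / D0 : ℤ) : ℝ) ≤ (M : ℝ) * C.b0 / D0 := by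
    have hle : ((M : ℤ) * C.b0 / D0) * D0 ≤ (M : ℤ) * C.b0 := Int.ediv_mul_le _ hD0p.ne'
    have hle' : ((((M : ℤ) * C.b0 / D0 : ℤ) : ℝ)) * (D0 : ℝ) ≤ (M : ℝ) * C.b0 := by exact_mod_cast hle
    rwa [le_div_iff₀ (by exact_mod_cast hD0p)]
  -- ceiling part
  have h2 : (M : ℝ) * C.b1 / D1 ≤ ((((M : ℤ) * C.b1 + D1 - 1) / D1 : ℤ) : ℝ) := by
    set A : ℤ := (M : ℤ) * C.b1 + D1 - 1 with hA
    have hdiv : A % D1 + D1 * (A / D1) = A := Int.emod_add_mul_ediv A D1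
    have hmod := Int.emod_lt_of_pos A hD1p
    have hge : (M : ℤ) * C.b1 ≤ (A / D1) * D1 := by
      have : D1 * (A / D1) = A - A % D1 := by linarith
      have hmod0 := Int.emod_nonneg A hD1p.ne'
      nlinarith
    have hge' : (M : ℝ) * C.b1 ≤ ((A / D1 : ℤ) : ℝ) * (D1 : ℝ) := by exact_mod_cast hge
    rwa [div_le_iff₀ (by exact_mod_cast hD1p)]
  have eu : (1 : ℝ) / (k + C.u) = (C.b0 : ℝ) / D0 := by
    unfold Cell.u; rw [hD0]; push_cast
    have : (0 : ℝ) < C.b0 := by exact_mod_cast hb0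
    field_simp
  have ev : (1 : ℝ) / (k + C.v) = (C.b1 : ℝ) / D1 := by
    unfold Cell.v; rw [hD1]; push_cast
    have : (0 : ℝ) < C.b1 := by exact_mod_cast hb1
    field_simp
  unfold Cell.lbTerm
  rw [← hD0, ← hD1, eu, ev]
  push_cast
  have h1' := mul_le_mul_of_nonneg_left h1 hc
  have h2' := mul_le_mul_of_nonneg_left h2 hc
  have e1 : (M : ℝ) * C.b0 / D0 = M * ((C.b0 : ℝ) / D0) := by ring
  have e2 : (M : ℝ) * C.b1 / D1 = M * ((C.b1 : ℝ) / D1) := by ring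
  rw [e1] at h1'; rw [e2] at h2'
  nlinarith

/-- The contribution of a cell dominates its integer bound. [folklore] -/
theorem lbSum_le (hC : C ∈ table) :
    (C.lbSum : ℝ) ≤ M * ∑ k ∈ range (K + 1), climit (k, C) := by
  have e : (C.lbSum : ℝ)
      = ∑ k ∈ range (K + 1), ((if C.good k = true then C.lbTerm k else 0 : ℤ) : ℝ) := by
    rw [Cell.lbSum, sum_range_eq_list_sum, Int.cast_list_sum, List.map_map]
    rfl
  rw [e, Finset.mul_sum]
  refine Finset.sum_le_sum fun k _ => ?_
  unfold climit
  by_cases hgood : C.good k = true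
  · simp only [hgood, if_true]
    exact lbTerm_le hC k
  · simp [hgood]

/-- `C⋆` cell by cell. [folklore] -/
theorem Cstar_eq : Cstar = ∑ C ∈ table.toFinset, ∑ k ∈ range (K + 1), climit (k, C) := by
  rw [Cstar, pairs, Finset.sum_product, Finset.sum_comm]

/-- `tableLB ≤ M · C⋆`. [cite: Zudilin2004, §8 p. 271] -/
theorem tableLB_le_Cstar : (tableLB : ℝ) ≤ M * Cstar := by
  rw [Cstar_eq, Finset.mul_sum, List.sum_toFinset _ table_nodup, tableLB, Int.cast_list_sum,
    List.map_map]
  refine List.sum_le_sum fun C hC => ?_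
  exact lbSum_le hC

/-- **`c₂ < C⋆`** (the kernel-certified inequality `tableLB_gt`). [cite: Zudilin2004, §8 p. 271] -/
theorem c2_lt_Cstar : (c2num : ℝ) / c2den < Cstar := by
  have h' : (c2num : ℝ) * M < c2den * (tableLB : ℝ) := by
    have h := tableLB_gt
    exact_mod_cast h
  have hM : (0 : ℝ) < M := by unfold M; positivity
  have hd : (0 : ℝ) < c2den := by unfold c2den; norm_num
  have h2 : (c2den : ℝ) * (tableLB : ℝ) ≤ c2den * (M * Cstar) :=
    mul_le_mul_of_nonneg_left tableLB_le_Cstar hd.le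
  rw [div_lt_iff₀ hd]
  have h3 : (c2num : ℝ) * M < (Cstar * c2den) * M := by nlinarith
  exact lt_of_mul_lt_mul_right h3 hM.le

/-- **Growth of `Φₙ`** in certified form: `e^{(c2num/c2den) n} ≤ Φₙ` for all large `n`.
[cite: Zudilin2004, §8 p. 271] -/
theorem Phi_growth_cert :
    ∀ᶠ n : ℕ in atTop, Real.exp ((c2num : ℝ) / c2den * n) ≤ (Phi n : ℝ) := by
  have hev := tendsto_Lfun_div.eventually (Ioi_mem_nhds c2_lt_Cstar)
  filter_upwards [hev, eventually_ge_atTop N₀, eventually_gt_atTop 0] with n hn hN hn0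
  have hn0' : (0 : ℝ) < n := by exact_mod_cast hn0
  rw [lt_div_iff₀ hn0'] at hn
  have h1 := Lfun_le_log_Phi hN
  have hPhi : (0 : ℝ) < Phi n := by exact_mod_cast Phi_pos n
  rw [← Real.le_log_iff_exp_le hPhi]
  linarith

end PhiCert

-- MAIN
/-- **Growth of Zudilin's arithmetic factor** ([Zudilin2004, proof of Theorem 3]: `log Φₙ / n →
403 − C₂ = 176.7505…`): `e^{176.6 n} ≤ Φₙ` for all large `n`. This is the hypothesis `hPhi` (with
`c₂ = 883/5`) of `Zudilin2004.zudilin_of_linearForms_of_lt`. [cite: Zudilin2004, §8 Prop. 5, Thm. 3, p. 270–271] -/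
theorem Phi_growth : ∀ᶠ n : ℕ in atTop, Real.exp ((883 / 5 : ℝ) * n) ≤ (Phi n : ℝ) := by
  have h := PhiCert.Phi_growth_cert
  have e : (PhiCert.c2num : ℝ) / PhiCert.c2den = 883 / 5 := by
    norm_num [PhiCert.c2num, PhiCert.c2den]
  rw [e] at h
  exact h

end Zudilin2004

end Literature.NumberTheory.Transcendental
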